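import Summits.HodgeConjecture.HodgeCM.Automorphic.ThetaCarrierReg_1

/-! PORT of `HodgeCM/Automorphic/ThetaCarrierReg.lean` (HodgeCMPerL run 82) — part 2: continuation of `Summits.HodgeConjecture.HodgeCM.Automorphic.ThetaCarrierReg_1` (split at a top-level declaration boundary by port_pkg.py; scope re-opened below; declarations unchanged). -/

-- port_pkg: scope re-opened for this part (file-level context, then the namespace/section stack open at the cut)
set_option autoImplicit false
noncomputable section
open MeasureTheory
open scoped InnerProductSpace CompactlySupported
namespace HodgeCM
namespace Universe
open HodgeCM.Prior.Perl34File HodgeCM.Prior.Perl34File.Perl34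
variable (U : Universe)
namespace ThetaModel
variable {U}
/-- (Ported verbatim from the HodgeCMPerL package; no docstring in the source.) -/
theorem ofRegCarrier_eq (D : U.RegThetaCarrier) (hA : D.Analytic) :
    ofRegCarrier D hA = ofRepCarrier D.toRepThetaCarrier hA.toRepThetaCarrier := rfl

end ThetaModel

end Universe

/-! ## 4. The headline theorems over a regular-model carrier -/

namespace Assembly

open HodgeCM.Prior.Perl34File HodgeCM.Prior.Perl34File.Perl34
open HodgeCM.PerL34 HodgeCM.PerL34.ArchC
open HodgeCM.Universe (RegThetaCarrier ThetaModel)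

variable (U : Universe)

/-- **Both realisation inputs over a regular-model carrier.**  Hypotheses: model facts `M`, the TWELVE analytic
axioms per context `hA`, the ten theta inputs `A`, Hodge–Riemann for `(2,0)`-forms. -/
theorem realisationExists_ofRegCarrier (M : U.ModelAxioms) (D : U.RegThetaCarrier) (hA : D.Analytic)
    (A : (ThetaModel.ofRegCarrier D hA).Inputs) (hHR : U.Fact_hodgeRiemann20) :
    U.RealisationExistsPerL ∧ U.RealisationExistsFace :=
  realisationExists_ofRepCarrier U M D.toRepThetaCarrier hA.toRepThetaCarrier A hHR

/-- **PerL over a regular-model carrier.** -/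
theorem perL_ofRegCarrier (M : U.ModelAxioms) (D : U.RegThetaCarrier) (hA : D.Analytic)
    (A : (ThetaModel.ofRegCarrier D hA).Inputs) (hHR : U.Fact_hodgeRiemann20) : U.PerL :=
  perL_ofRepCarrier U M D.toRepThetaCarrier hA.toRepThetaCarrier A hHR

/-- **COR-CM, END STATE over a regular-model carrier.** -/
theorem COR_CM_endState_ofRegCarrier (M : U.ModelAxioms) (h29 : U.Fact_weightSpan) (h30 : U.Fact_weightHodge)
    (hE : U.Qw8ExtProd) (hD : U.Qw8DualPushPull) (hMi : U.Qw8Milne) (D : U.RegThetaCarrier) (hA : D.Analytic)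
    (A : (ThetaModel.ofRegCarrier D hA).Inputs) (hHR : U.Fact_hodgeRiemann20) : U.HC_CM :=
  COR_CM_endState_ofRepCarrier U M h29 h30 hE hD hMi D.toRepThetaCarrier hA.toRepThetaCarrier A hHR

/-- **COR-CM, END STATE over a regular-model carrier, from the leaves**: `COR_CM_endState_ofRepCarrier_leaves'`
at `D.toRepThetaCarrier` — twelve (not fifteen) analytic axioms per seesaw context. -/
theorem COR_CM_endState_ofRegCarrier_leaves' (M : U.ModelAxioms) (h29 : U.Fact_weightSpan)
    (h30 : U.Fact_weightHodge) (hE : U.Qw8ExtProd) (hD : U.Qw8DualPushPull) (hMi : U.Qw8Milne)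
    (D : U.RegThetaCarrier) (hA : D.Analytic)
    (h07 : N07_hodgeRiemann20 U) (h09a : N09a_embCover (ThetaModel.ofRegCarrier D hA))
    (h09b : N09b_innerEmb (ThetaModel.ofRegCarrier D hA))
    (h12a : N12a_thetaSub (ThetaModel.ofRegCarrier D hA)) (h12b : N12b_signRecipe (ThetaModel.ofRegCarrier D hA))
    (hgen : ∀ {L : CMField} {ι₁ : L →+* ℂ} (V : HermSpace3 L ι₁) (c : SeesawCtx L),
      (ThetaModel.ofRegCarrier D hA).GoodCtx ι₁ c →
      N19w_genIdentity (ThetaModel.ofRegCarrier D hA) V c ((ThetaModel.ofRegCarrier D hA).t12 V c) 0 1)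
    (hcore : ∀ {L : CMField} {ι₁ : L →+* ℂ} (V : HermSpace3 L ι₁) (c : SeesawCtx L),
      (ThetaModel.ofRegCarrier D hA).GoodCtx ι₁ c →
      N19g_core (ThetaModel.ofRegCarrier D hA) V c ((ThetaModel.ofRegCarrier D hA).t34 V c) 2 3)
    (Pc : ∀ {L : CMField} {ι₁ : L →+* ℂ} (V : HermSpace3 L ι₁) (c : SeesawCtx L),
      C4a.PointedCore ((ThetaModel.ofRegCarrier D hA).core V c))
    (A12 : ∀ {L : CMField} {ι₁ : L →+* ℂ} (V : HermSpace3 L ι₁) (c : SeesawCtx L),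
      (ThetaModel.ofRegCarrier D hA).GoodCtx ι₁ c →
      Nonempty (ArchCDatum ((ThetaModel.ofRegCarrier D hA).core V c) ((ThetaModel.ofRegCarrier D hA).t12 V c)
        (Pc V c)))
    (A34 : ∀ {L : CMField} {ι₁ : L →+* ℂ} (V : HermSpace3 L ι₁) (c : SeesawCtx L),
      (ThetaModel.ofRegCarrier D hA).GoodCtx ι₁ c →
      Nonempty (ArchCDatum ((ThetaModel.ofRegCarrier D hA).core V c) ((ThetaModel.ofRegCarrier D hA).t34 V c)
        (Pc V c)))
    (h31 : ClusterOutputs (ThetaModel.ofRegCarrier D hA))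
    (h33 : WedgeToClasses.StepsPrintInput (ThetaModel.ofRegCarrier D hA)) : U.HC_CM :=
  COR_CM_endState_ofRepCarrier_leaves' U M h29 h30 hE hD hMi D.toRepThetaCarrier hA.toRepThetaCarrier h07 h09a h09b
    h12a h12b hgen hcore Pc A12 A34 h31 h33

end Assembly

end HodgeCM

-- port_pkg: scope closed for this part
end
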